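import Summits.BirchSwinnertonDyer.BirchSwinnertonDyer.Theorems.ManinLocalTwoThreeBracketSturmDefs
import HarnessLib

/-!
# Bracket–Sturm packaging, file 2/4: the ratio-bridge certificate as ONE modular form of weight `4k + 4`, Sturm's
# bound on its first `⌊(4k+4)μ₀(N)/12⌋ + 1` `q`-coefficients, and `𝓠(defect) = formalDefect`

Cell bsd-f2-manin, route `ManinLocalTwoThree` (cruxes C2 `ManinOddAtFour` stmt-22967, C3 `ManinPrimeToThreeAtNine`
stmt-22968).  AUTHOR: planner seat -an gen 53 (TURNKEYS T-an-g53-BS v1.1 `bdf541700739eea7` and T-an-g53-EC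
`195407b5d8884464`, HOME/an/g53/); landed by prover seat p2 gen 29, who only SPLIT the two turnkeys into four tree files
(`…BracketSturmDefs` ⊂ `…BracketSturm` ⊂ `…BracketSturmLists` ⊂ `…EtaCoefficientTables`) for the 400-line lint, all
definitions going to the first; the Lean bodies are byte-identical to the turnkeys section by section.  Fact-free,
standard axioms, `--supports` helper; nothing here proves C2/C3 for all `N`, Manin's conjecture or BSD.

CONTENTS: §0 niceness / automorphy bookkeeping on `Γ₀(N)`; §1 `defectForm = 0` ⟹ the bracket identity ⟹ `Λ(f) ⊆ Λ` (the tree's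
ratio bridge `RatioBridge.periodLattice_le_of_bracket_sq_of_weight`) ⟹ `|c(P)| = 1` by p3's Néron squeeze
(`abs_maninConstant_eq_one_of_defectForm_eq_zero`, `not_dvd_…`); §2 Sturm in weight `k'` at level `N`
(`modularForm_eq_zero_of_coeff_eq_zero`, tree `ModularCurveSturmProofs` + `index_gamma0_eq_gamma0Index_holds`) and the
coefficient form `abs_maninConstant_eq_one_of_defectForm_coeff_eq_zero`; §3 the formal `q`-expansion of the defect:
`𝓠(DF) = θ𝓠(F)`, `𝓠([A,B])`, `𝓠(cubic)`, `𝓠(defect) = formalDefect 1 4 g₂ g₃ 𝓠(A) 𝓠(B) 𝓠(f)`.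
[cite: Manin1972, Prop. 1.4] [cite: Sturm1987, Thm. 1] [cite: Zagier2008, §5.1 Prop. 15] [cite: AgasheRibetStein2006, §§1–2]
-/

set_option autoImplicit false
-- lint-debt: the directory name repeats the summit name (sibling precedent `ManinLocalTwoThreeRatioBridge.lean`)
set_option linter.dupNamespace false

noncomputable section

open Complex Filter Topology Set Function Asymptotics
open UpperHalfPlane hiding I
open scoped Real Topology Manifold MatrixGroups ModularForm PeriodPair
open CongruenceSubgroup Derivative PowerSeries
open Literature.NumberTheory.ModularForms
open Literature.NumberTheory.EllipticCurves Literature.NumberTheory.EllipticCurves.ModularForms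

namespace Summit.BirchSwinnertonDyer.BirchSwinnertonDyer.Theorems.ManinLocalTwoThree.BracketSturm

open RatioBridge

variable {N : ℕ} [NeZero N] {k : ℤ}

/-! ## §0 Modular forms on `Γ₀(N)`: automorphy in coordinates, niceness at `i∞` -/

omit [NeZero N] in
/-- A modular form of weight `k` on `Γ₀(N)` transforms with the factor `(cτ + d)^k`. [folklore] -/
theorem apply_smul_eq (A : ModularForm (Gamma0 N) k) (γ : Gamma0 N) (τ : ℍ) :
    A ((γ : SL(2, ℤ)) • τ) = (((γ : SL(2, ℤ)) 1 0 : ℂ) * τ + ((γ : SL(2, ℤ)) 1 1 : ℂ)) ^ k * A τ := by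
  rw [SlashInvariantForm.slash_action_eqn_SL'' A γ.2 τ, ModularGroup.denom_apply]

/-- A modular form on `Γ₀(N)` is `1`-periodic, holomorphic and bounded at `i∞` ("nice"). [folklore] -/
theorem nice_coe (A : ModularForm (Gamma0 N) k) :
    Periodic (⇑A ∘ ofComplex) 1 ∧ MDifferentiable 𝓘(ℂ) 𝓘(ℂ) ⇑A ∧ IsBoundedAtImInfty ⇑A :=
  ⟨SlashInvariantFormClass.periodic_comp_ofComplex A (one_mem_strictPeriods_coe_gamma0 N),
    ModularFormClass.holo A, ModularFormClass.bdd_at_infty A⟩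

/-- A cusp form on `Γ₀(N)` is nice. [folklore] -/
theorem nice_coe_cuspForm (f : CuspForm (Gamma0 N) k) :
    Periodic (⇑f ∘ ofComplex) 1 ∧ MDifferentiable 𝓘(ℂ) 𝓘(ℂ) ⇑f ∧ IsBoundedAtImInfty ⇑f :=
  ⟨SlashInvariantFormClass.periodic_comp_ofComplex f (one_mem_strictPeriods_coe_gamma0 N),
    ModularFormClass.holo f, ModularFormClass.bdd_at_infty f⟩

/-- `D` of a nice function is nice. [cite: Zagier2008, §5.1] -/
theorem nice_D {F : ℍ → ℂ} (hF : Periodic (F ∘ ofComplex) 1 ∧ MDifferentiable 𝓘(ℂ) 𝓘(ℂ) F ∧ IsBoundedAtImInfty F) :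
    Periodic (D F ∘ ofComplex) 1 ∧ MDifferentiable 𝓘(ℂ) 𝓘(ℂ) (D F) ∧ IsBoundedAtImInfty (D F) :=
  ⟨periodic_D hF.1, normalizedDerivOfComplex_mdifferentiable hF.2.1, isBoundedAtImInfty_D hF.1 hF.2.1 hF.2.2⟩

/-- `d/dτ = 2πi·D`. [folklore] -/
theorem deriv_comp_ofComplex_eq (F : ℍ → ℂ) (τ : ℍ) : deriv (F ∘ ofComplex) τ = 2 * π * Complex.I * D F τ := by
  rw [show D F τ = (2 * π * Complex.I)⁻¹ * deriv (F ∘ ofComplex) τ from rfl, ← mul_assoc,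
    mul_inv_cancel₀ two_pi_I_ne_zero, one_mul]

/-! ## §1 `defectForm = 0` ⟹ bracket identity ⟹ `Λ(f) ⊆ Λ` ⟹ `|c(P)| = 1` -/

/-- **`defectForm = 0` is the bracket identity `(A′B − AB′)² = (2πif)²(4A³ − g₂AB² − g₃B³)B` on `ℍ`.**
[cite: Manin1972, Prop. 1.4] -/
theorem bracketIdentity_of_defectForm_eq_zero (A B : ModularForm (Gamma0 N) k) (f : CuspForm (Gamma0 N) 2)
    (g₂ g₃ : ℂ) (h : defectForm A B f g₂ g₃ = 0) (τ : ℍ) :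
    (deriv (⇑A ∘ ofComplex) τ * B τ - A τ * deriv (⇑B ∘ ofComplex) τ) ^ 2 =
      (2 * π * Complex.I * f τ) ^ 2 * (4 * A τ ^ 3 - g₂ * A τ * B τ ^ 2 - g₃ * B τ ^ 3) * B τ := by
  have h1 : defectForm A B f g₂ g₃ τ = 0 := by rw [h, ModularForm.zero_apply]
  rw [defectForm_apply] at h1
  rw [deriv_comp_ofComplex_eq ⇑A, deriv_comp_ofComplex_eq ⇑B]
  linear_combination (2 * (π : ℂ) * Complex.I) ^ 2 * h1

omit [NeZero N] in
/-- A modular form with a non-zero `q`-coefficient is non-zero. [folklore] -/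
theorem ne_zero_of_qExpansion_coeff_ne_zero {k' : ℤ} (F : ModularForm (Gamma0 N) k') {n : ℕ}
    (h : (qExpansion 1 ⇑F).coeff n ≠ 0) : F ≠ 0 := by
  rintro rfl
  rw [ModularForm.coe_zero, UpperHalfPlane.qExpansion_zero, map_zero] at h
  exact h rfl

/-- **A common non-vanishing point**: if `B ≠ 0` and `cubicForm A B g₂ g₃ ≠ 0` then `B(τ₀) ≠ 0` and
`4A³ − g₂AB² − g₃B³ ≠ 0` at one point `τ₀` (the `q`-expansion ring `ℂ⟦q⟧` has no zero divisors). [folklore] -/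
theorem exists_nondegenerate (A B : ModularForm (Gamma0 N) k) (g₂ g₃ : ℂ) (hB : B ≠ 0)
    (hC : cubicForm A B g₂ g₃ ≠ 0) :
    ∃ τ₀ : ℍ, B τ₀ ≠ 0 ∧ 4 * A τ₀ ^ 3 - g₂ * A τ₀ * B τ₀ ^ 2 - g₃ * B τ₀ ^ 3 ≠ 0 := by
  have hΓ := one_mem_strictPeriods_coe_gamma0 N
  have hq : qExpansion 1 ⇑((cubicForm A B g₂ g₃).mul B) ≠ 0 := by
    rw [ModularForm.qExpansion_mul one_pos hΓ]
    exact mul_ne_zero (fun h0 ↦ hC ((ModularForm.qExpansion_eq_zero_iff one_pos hΓ _).mp h0))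
      (fun h0 ↦ hB ((ModularForm.qExpansion_eq_zero_iff one_pos hΓ _).mp h0))
  have hne : ∃ τ₀ : ℍ, ((cubicForm A B g₂ g₃).mul B) τ₀ ≠ 0 := by
    by_contra! h'
    apply hq
    have : (cubicForm A B g₂ g₃).mul B = 0 := ModularForm.ext fun τ ↦ by rw [h' τ, ModularForm.zero_apply]
    rw [this, ModularForm.coe_zero, UpperHalfPlane.qExpansion_zero]
  obtain ⟨τ₀, hτ₀⟩ := hne
  rw [ModularForm.coe_mul, Pi.mul_apply, cubicForm_apply] at hτ₀
  exact ⟨τ₀, right_ne_zero_of_mul hτ₀, left_ne_zero_of_mul hτ₀⟩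

/-- **`Λ(f) ⊆ Λ` from the vanishing of the defect.** [cite: Manin1972, Prop. 1.4] [cite: WhittakerWatson1927, §20.22] -/
theorem periodLattice_le_of_defectForm_eq_zero (f : CuspForm (Gamma0 N) 2) (hf : f ≠ 0) (L : PeriodPair)
    (A B : ModularForm (Gamma0 N) k) (h0 : defectForm A B f L.g₂ L.g₃ = 0) (hB : B ≠ 0)
    (hC : cubicForm A B L.g₂ L.g₃ ≠ 0) : ∀ z ∈ periodLattice f, z ∈ L.lattice :=
  periodLattice_le_of_bracket_sq_of_weight f hf L ⇑A ⇑B (ModularFormClass.holo A) (ModularFormClass.holo B) k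
    (apply_smul_eq A) (apply_smul_eq B) (bracketIdentity_of_defectForm_eq_zero A B f L.g₂ L.g₃ h0)
    (exists_nondegenerate A B L.g₂ L.g₃ hB hC)

/-- **`|c(P)| = 1` from the vanishing of the defect** (with p3's Néron squeeze): `W₀/ℚ` globally minimal with Néron
period pair `L₀`, `P` an `X₀(N)`-datum of a globally minimal `W/ℚ` with the lattice clause, `A, B ∈ M_k(Γ₀(N))` with
`defectForm A B P.f g₂(L₀) g₃(L₀) = 0`, `B ≠ 0`, `cubicForm ≠ 0`. [cite: AgasheRibetStein2006, §§1–2] [cite: CremonaAlgorithms1997, §2.10] -/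
theorem abs_maninConstant_eq_one_of_defectForm_eq_zero
    (W₀ : WeierstrassCurve ℚ) [W₀.IsElliptic] [W₀.IsGloballyMinimal] (L₀ : PeriodPair)
    (hL₀ : IsNeronLatticeOf (W₀.baseChange ℂ) L₀)
    (W : WeierstrassCurve ℚ) [W.IsElliptic] [W.IsGloballyMinimal] (P : ModularParametrizationData W N)
    (hopt : ∀ z ∈ P.L.lattice, ∃ w ∈ periodLattice P.f, z = P.c * w)
    (A B : ModularForm (Gamma0 N) k) (h0 : defectForm A B P.f L₀.g₂ L₀.g₃ = 0) (hB : B ≠ 0)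
    (hC : cubicForm A B L₀.g₂ L₀.g₃ ≠ 0) : |P.maninConstant| = 1 :=
  NeronSqueeze.abs_maninConstant_eq_one_of_periodLattice_le W₀ L₀ hL₀ W P
    (periodLattice_le_of_defectForm_eq_zero P.f (f_ne_zero P) L₀ A B h0 hB hC) hopt

/-- **No prime divides `c(P)`** under the same hypotheses. [cite: AgasheRibetStein2006, §§1–2] -/
theorem not_dvd_maninConstant_of_defectForm_eq_zero
    (W₀ : WeierstrassCurve ℚ) [W₀.IsElliptic] [W₀.IsGloballyMinimal] (L₀ : PeriodPair)
    (hL₀ : IsNeronLatticeOf (W₀.baseChange ℂ) L₀)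
    (W : WeierstrassCurve ℚ) [W.IsElliptic] [W.IsGloballyMinimal] (P : ModularParametrizationData W N)
    (hopt : ∀ z ∈ P.L.lattice, ∃ w ∈ periodLattice P.f, z = P.c * w)
    (A B : ModularForm (Gamma0 N) k) (h0 : defectForm A B P.f L₀.g₂ L₀.g₃ = 0) (hB : B ≠ 0)
    (hC : cubicForm A B L₀.g₂ L₀.g₃ ≠ 0) {p : ℤ} (hp : p.natAbs ≠ 1) : ¬ p ∣ P.maninConstant :=
  NeronSqueeze.not_dvd_maninConstant_of_periodLattice_le W₀ L₀ hL₀ W P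
    (periodLattice_le_of_defectForm_eq_zero P.f (f_ne_zero P) L₀ A B h0 hB hC) hopt hp

/-! ## §2 Sturm: the defect vanishes iff its first `⌊(4k+4)μ₀(N)/12⌋ + 1` coefficients do -/

/-- The Sturm index term for `Γ₀(N)`: `#(SL₂(ℤ)/Γ₀(N)) = μ₀(N) = ∏_{p^e ∥ N} p^{e−1}(p+1)`.
[cite: ShimuraIATAF1971, Prop. 1.43] -/
theorem card_quotient_gamma0 :
    Nat.card (𝒮ℒ ⧸ ((Gamma0 N : Subgroup SL(2, ℤ)) : Subgroup (GL (Fin 2) ℝ)).subgroupOf 𝒮ℒ) = gamma0Index N := by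
  have hidx : (Gamma0 N).index = gamma0Index N := index_gamma0_eq_gamma0Index_holds N
  rw [card_quotient_subgroupOf_eq_index, hidx]

/-- **Sturm for `M_{k'}(Γ₀(N))`**: `a_i(F) = 0` for all `i < m` with `⌊k'μ₀(N)/12⌋ < m` forces `F = 0`.
[cite: Sturm1987, Thm. 1] -/
theorem modularForm_eq_zero_of_coeff_eq_zero {k' : ℤ} (F : ModularForm (Gamma0 N) k') {m : ℕ}
    (hcoeff : ∀ i < m, (qExpansion 1 ⇑F).coeff i = 0) (hm : (k' * gamma0Index N).toNat / 12 < m) : F = 0 := by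
  refine modularForm_eq_zero_of_qExpansion_coeff_eq_zero (one_mem_strictPeriods_coe_gamma0 N) F hcoeff ?_
  rwa [card_quotient_gamma0]

/-- **Sturm, decay form**: `F = O(e^{−2πm·Im τ})` at `i∞` with `⌊k'μ₀(N)/12⌋ < m` forces `F = 0`.
[cite: Sturm1987, Thm. 1] -/
theorem modularForm_eq_zero_of_isBigO {k' : ℤ} (F : ModularForm (Gamma0 N) k') {m : ℕ}
    (hO : (⇑F) =O[atImInfty] fun τ : ℍ ↦ Real.exp (-2 * π * m * τ.im)) (hm : (k' * gamma0Index N).toNat / 12 < m) :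
    F = 0 := by
  refine DFunLike.ext' ((coe_eq_zero_of_isBigO_exp' F hO ?_).trans ModularForm.coe_zero.symm)
  rw [card_quotient_gamma0]
  exact_mod_cast hm

/-- **Sturm, `Tendsto` form** (the shape the level files' remainder calculus produces): `F(τ)/q^m → c` at `i∞`
with `⌊k'μ₀(N)/12⌋ < m` forces `F = 0`. [cite: Sturm1987, Thm. 1] -/
theorem modularForm_eq_zero_of_tendsto {k' : ℤ} (F : ModularForm (Gamma0 N) k') {m : ℕ} {c : ℂ}
    (h : Tendsto (fun τ : ℍ ↦ F τ / Periodic.qParam 1 (τ : ℂ) ^ m) atImInfty (𝓝 c))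
    (hm : (k' * gamma0Index N).toNat / 12 < m) : F = 0 := by
  refine modularForm_eq_zero_of_isBigO F ?_ hm
  have h1 : (fun τ : ℍ ↦ F τ / Periodic.qParam 1 (τ : ℂ) ^ m) =O[atImInfty] fun _ : ℍ ↦ (1 : ℝ) := h.isBigO_one ℝ
  have h2 : (fun τ : ℍ ↦ Periodic.qParam 1 (τ : ℂ) ^ m) =O[atImInfty] fun τ : ℍ ↦ Real.exp (-2 * π * m * τ.im) := by
    refine IsBigO.of_bound 1 (Eventually.of_forall fun τ ↦ ?_)
    rw [norm_pow, Periodic.norm_qParam, Real.norm_eq_abs, abs_of_pos (Real.exp_pos _), one_mul,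
      ← Real.exp_nat_mul, UpperHalfPlane.coe_im]
    apply le_of_eq
    congr 1
    ring
  have h3 := h1.mul h2
  simp only [one_mul] at h3
  refine h3.congr' (Eventually.of_forall fun τ ↦ ?_) EventuallyEq.rfl
  have hq : Periodic.qParam 1 (τ : ℂ) ≠ 0 := Complex.exp_ne_zero _
  change F τ / Periodic.qParam 1 (τ : ℂ) ^ m * Periodic.qParam 1 (τ : ℂ) ^ m = F τ
  rw [div_mul_cancel₀ _ (pow_ne_zero _ hq)]

/-- **`|c(P)| = 1` from finitely many `q`-coefficients of the defect.** [cite: Sturm1987, Thm. 1] [cite: AgasheRibetStein2006, §§1–2] -/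
theorem abs_maninConstant_eq_one_of_defectForm_coeff_eq_zero
    (W₀ : WeierstrassCurve ℚ) [W₀.IsElliptic] [W₀.IsGloballyMinimal] (L₀ : PeriodPair)
    (hL₀ : IsNeronLatticeOf (W₀.baseChange ℂ) L₀)
    (W : WeierstrassCurve ℚ) [W.IsElliptic] [W.IsGloballyMinimal] (P : ModularParametrizationData W N)
    (hopt : ∀ z ∈ P.L.lattice, ∃ w ∈ periodLattice P.f, z = P.c * w)
    (A B : ModularForm (Gamma0 N) k) {m : ℕ} (hm : ((4 * k + 4) * gamma0Index N).toNat / 12 < m)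
    (hcoeff : ∀ i < m, (qExpansion 1 ⇑(defectForm A B P.f L₀.g₂ L₀.g₃)).coeff i = 0) (hB : B ≠ 0)
    (hC : cubicForm A B L₀.g₂ L₀.g₃ ≠ 0) : |P.maninConstant| = 1 :=
  abs_maninConstant_eq_one_of_defectForm_eq_zero W₀ L₀ hL₀ W P hopt A B
    (modularForm_eq_zero_of_coeff_eq_zero _ hcoeff hm) hB hC

/-! ## §3 The formal `q`-expansion of the defect -/

/-- **`𝓠(DF) = θ·𝓠(F)`** for a nice `F` (tree `qExpansion_D_coeff`). [cite: Zagier2008, §5.1] -/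
theorem qExpansion_D_eq_theta {F : ℍ → ℂ}
    (hF : Periodic (F ∘ ofComplex) 1 ∧ MDifferentiable 𝓘(ℂ) 𝓘(ℂ) F ∧ IsBoundedAtImInfty F) :
    qExpansion 1 (D F) = theta (qExpansion 1 F) := by
  ext n
  rw [coeff_theta]
  exact qExpansion_D_coeff hF.1 hF.2.1 hF.2.2 n

/-- The bracket as a function. [folklore] -/
theorem coe_bracketForm (A B : ModularForm (Gamma0 N) k) : (bracketForm A B : ℍ → ℂ) = D ⇑A * ⇑B - ⇑A * D ⇑B := by
  funext τ
  simp only [bracketForm_apply, Pi.sub_apply, Pi.mul_apply]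

/-- **`𝓠([A, B]) = θa·b − a·θb`**, `a = 𝓠(A)`, `b = 𝓠(B)`. [cite: Zagier2008, §5.1] -/
theorem qExpansion_bracketForm (A B : ModularForm (Gamma0 N) k) :
    qExpansion 1 ⇑(bracketForm A B) = formalBracket (qExpansion 1 ⇑A) (qExpansion 1 ⇑B) := by
  have nA := nice_coe A
  have nB := nice_coe B
  rw [coe_bracketForm, QExpansionAlgebra.qExpansion_sub_of_nice one_pos (QExpansionAlgebra.nice_mul (nice_D nA) nB)
      (QExpansionAlgebra.nice_mul nA (nice_D nB)),
    QExpansionAlgebra.qExpansion_mul_of_nice one_pos (nice_D nA) nB,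
    QExpansionAlgebra.qExpansion_mul_of_nice one_pos nA (nice_D nB), qExpansion_D_eq_theta nA,
    qExpansion_D_eq_theta nB, formalBracket]

/-- The cubic as a function. [folklore] -/
theorem coe_cubicForm (A B : ModularForm (Gamma0 N) k) (g₂ g₃ : ℂ) :
    (cubicForm A B g₂ g₃ : ℍ → ℂ) = (4 : ℂ) • (⇑A * ⇑A * ⇑A) - g₂ • (⇑A * (⇑B * ⇑B)) - g₃ • (⇑B * ⇑B * ⇑B) := by
  funext τ
  simp only [cubicForm_apply, Pi.sub_apply, Pi.smul_apply, Pi.mul_apply, smul_eq_mul]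
  ring

/-- **`𝓠(4A³ − g₂AB² − g₃B³) = 4a³ − g₂ab² − g₃b³`.** [folklore] -/
theorem qExpansion_cubicForm (A B : ModularForm (Gamma0 N) k) (g₂ g₃ : ℂ) :
    qExpansion 1 ⇑(cubicForm A B g₂ g₃) = formalCubic 4 g₂ g₃ (qExpansion 1 ⇑A) (qExpansion 1 ⇑B) := by
  have nA := nice_coe A
  have nB := nice_coe B
  have nAAA := QExpansionAlgebra.nice_mul (QExpansionAlgebra.nice_mul nA nA) nA
  have nBB := QExpansionAlgebra.nice_mul nB nB
  have nABB := QExpansionAlgebra.nice_mul nA nBB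
  have nBBB := QExpansionAlgebra.nice_mul nBB nB
  rw [coe_cubicForm,
    QExpansionAlgebra.qExpansion_sub_of_nice one_pos (QExpansionAlgebra.nice_sub (QExpansionAlgebra.nice_smul _ nAAA)
      (QExpansionAlgebra.nice_smul _ nABB)) (QExpansionAlgebra.nice_smul _ nBBB),
    QExpansionAlgebra.qExpansion_sub_of_nice one_pos (QExpansionAlgebra.nice_smul _ nAAA)
      (QExpansionAlgebra.nice_smul _ nABB),
    QExpansionAlgebra.qExpansion_smul_of_nice one_pos _ nAAA, QExpansionAlgebra.qExpansion_smul_of_nice one_pos _ nABB,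
    QExpansionAlgebra.qExpansion_smul_of_nice one_pos _ nBBB,
    QExpansionAlgebra.qExpansion_mul_of_nice one_pos (QExpansionAlgebra.nice_mul nA nA) nA,
    QExpansionAlgebra.qExpansion_mul_of_nice one_pos nA nA, QExpansionAlgebra.qExpansion_mul_of_nice one_pos nA nBB,
    QExpansionAlgebra.qExpansion_mul_of_nice one_pos nBB nB, QExpansionAlgebra.qExpansion_mul_of_nice one_pos nB nB,
    smul_eq_C_mul, smul_eq_C_mul, smul_eq_C_mul, formalCubic]

/-- The defect as a function. [folklore] -/
theorem coe_defectForm (A B : ModularForm (Gamma0 N) k) (f : CuspForm (Gamma0 N) 2) (g₂ g₃ : ℂ) :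
    (defectForm A B f g₂ g₃ : ℍ → ℂ) =
      ⇑(bracketForm A B) * ⇑(bracketForm A B) - ⇑f * ⇑f * ⇑(cubicForm A B g₂ g₃) * ⇑B := by
  funext τ
  simp only [defectForm, ModularForm.sub_apply, ModularForm.coe_mcast, ModularForm.coe_mul, Pi.mul_apply,
    Pi.sub_apply, coe_ofCusp]

/-- **THE `q`-EXPANSION OF THE DEFECT IS THE FORMAL DEFECT OF THE `q`-EXPANSIONS**:
`𝓠([A,B]² − f²(4A³ − g₂AB² − g₃B³)B) = (θa·b − a·θb)² − φ²(4a³ − g₂ab² − g₃b³)b`. [cite: Zagier2008, §5.1] -/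
theorem qExpansion_defectForm (A B : ModularForm (Gamma0 N) k) (f : CuspForm (Gamma0 N) 2) (g₂ g₃ : ℂ) :
    qExpansion 1 ⇑(defectForm A B f g₂ g₃) =
      formalDefect 1 4 g₂ g₃ (qExpansion 1 ⇑A) (qExpansion 1 ⇑B) (qExpansion 1 ⇑f) := by
  have nB := nice_coe B
  have nf := nice_coe_cuspForm f
  have nW := nice_coe (bracketForm A B)
  have nC := nice_coe (cubicForm A B g₂ g₃)
  have nff := QExpansionAlgebra.nice_mul nf nf
  have nffC := QExpansionAlgebra.nice_mul nff nC
  rw [coe_defectForm, QExpansionAlgebra.qExpansion_sub_of_nice one_pos (QExpansionAlgebra.nice_mul nW nW)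
      (QExpansionAlgebra.nice_mul nffC nB),
    QExpansionAlgebra.qExpansion_mul_of_nice one_pos nW nW, QExpansionAlgebra.qExpansion_mul_of_nice one_pos nffC nB,
    QExpansionAlgebra.qExpansion_mul_of_nice one_pos nff nC, QExpansionAlgebra.qExpansion_mul_of_nice one_pos nf nf,
    qExpansion_bracketForm, qExpansion_cubicForm, formalDefect, map_one, one_mul]

end Summit.BirchSwinnertonDyer.BirchSwinnertonDyer.Theorems.ManinLocalTwoThree.BracketSturm

end
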